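import Summits.QuantumFields.YangMills.Theorems.UnitScaleTiltProp7SectET3NormGCanonical
import Literature.MathematicalPhysics.QuantumFieldTheory.Balaban1983to89.B9CoRealizesRel
import Literature.MathematicalPhysics.QuantumFieldTheory.Balaban1983to89.B9RWSumsReadsNbr
import Literature.MathematicalPhysics.QuantumFieldTheory.Balaban1983to89.B9RWSums344InputFam
import HarnessLib

/-!
# Route `UnitScaleTilt` (α), node N06(d = 3), the record-species leaf behind `norm_G` — **THE CANONICAL KERNEL FAMILY OF A MODEL OPERATOR LAYER: the K-halves of ALL SIX
# structural rows `hcoR`, `hco1R`, `hcoG`, `hl2N`, `hH1N`, `hIF` of `Prop7SectET3N06LeavesRecordNormG.normG_row_of_recordObligations` are inhabited AT ONCE, for ANY model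
# operators and evaluation maps, by ONE `K : B9.KernelFamily` — modulo the K-FREE evaluation rows only** (extends ✓ `Prop7SectET3NormGCanonical.exists_kernelFamily_glob_canonical`,
# which did the three (3.47) co-readings `hcoG`, to the (3.42) entries `e`, the (3.43) Hölder quantity `h1`, the (3.44)∕(3.45) input quantities `e4`∕`h2` and the six (3.46) L² entries `l2`)

Cell `ym-inputs` (D-0154 (2); desk `ym-inputs-plan-1` INPUT-LIST v5 §4 row p05 = I-06 (d) «structural rows … for a concrete `𝔬_T3`»), seat ym-inputs-p05.  Count-neutral helper
(`--supports stmt-QuantumFields-20520 --as helper`; RULING g26-№2 «B0 needs N06(d = 3)»); registry untouched; THEOREMS ONLY (0 `def`, 0 `sorry`); NOTHING of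
[Balaban1985BackgroundPropagators] is asserted.

THE POINT.  In the five co-reading schemas the T³ leaf displays — `B9CoRealizesRel.CoRealizesRel` ((3.42) entries `K.e n`), `B9Ineq347CoReading.CoReadsGlob` ((3.47) `K.glob n`),
`B9RWSumsReadsNbr.L2ReadsNbr` ((3.46) `K.l2 n`), `B9RWSumsReadsNbr.H1ReadsNbr` ((3.43) `K.h1`), `B9RWSums344InputFam.InputReadsFam` ((3.44) `K.e4`, (3.45) `K.h2`) — EVERY field that
mentions the kernel family is an `obs`-type UPPER READING («the entry is ≤ every valid constant»: print's (3.41) p. 397 *«the smallest number C such, that …»*), and every other field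
(`off`, `bound`, `wbound`, `l2bound`, `isLoc`, `loc_le`, the sign facts) is a property of the EVALUATION MAPS `ev`∕`evY`, the block maps and the geometry's functionals alone.  Hence for
ANY background-indexed model operators (here in the letters of the 𝔊-side leaf: `G U` for 𝔊(U), `D U`∕`Dstar U` for ∇_U∕∇*_U, the direction letters `Dd`∕`Dds`, the probes `𝔭`, the
input block norms `bHX ε`) the canonical entries — (3.42)∕(3.44): the finite fibrewise SUPS (with DOMINATION of the operator by the entry); (3.47): the weighted sups of ✓
`exists_glob_canonical` (with domination); (3.43)∕(3.45)∕(3.46): the INFIMUM OF THE VALID CONSTANTS (the greatest reading the schema allows, `exists_inf_canonical`) — inhabit the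
K-halves of all six rows simultaneously.  CONSEQUENCE for sub-row (d) of I-06: the concrete T³ instance owes NO kernel family and NO structural row; it owes the ten evaluation facts
(displayed here as `hoff hoffY hbd hbdY hwb hwbY hl2b hl2bY hloc hlocle`) about its own `ev`∕`evY`∕`bHX`, and the sign facts are ✓ `modelSignsOn_geo9K` ∕ `geoOK_geo9K`.

WHAT IS PROVED (ns `…Theorems.Prop7SectET3KernelFamilyCanonical`).
* §1 ★ `exists_inf_canonical` (the infimum of the valid constants: nonnegative, below every valid constant, above every other lower reading), ★★ `exists_e_canonical` (the (3.42)-type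
  entry of one background-indexed operator relative to a site relation `Rel`: `e U λ y := sup ({0} ∪ {|(A U (ev λ))(x)| : Rel (bu x) y})`, nonnegative, the `obs` clause, DOMINATION).
* §2 ★★★ `exists_kernelFamily_structural` — the six displayed K-rows of the 𝔊-side record leaf for every `U`, for ONE `K`, from the K-free evaluation rows and the sign facts, with the
  free members `K.e 3 = e3`, `K.glob 3 = g3` prescribed, PLUS the dominations of the model by the entries `e 0∕1∕2`, `e4`, `glob 0∕1∕2` (the latter at `γ = −3`, n = 0, 1 are the
  `hglob` readings of the `norm_G` consumer) and their nonnegativity.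
HONEST SCOPE: finite suprema ∕ infima ([folklore]); no estimate of [B9]; the concrete T³ letters (layer 0) are NOT defined here; N06(d = 3) NOT discharged; nothing here claims EX, the
crux, d = 4 or the mass gap; YM₃ on T³ is ladder rung R3, not the Clay problem.

References: T. Bałaban, CMP **99** (1985) 389–434 [Balaban1985BackgroundPropagators] ((3.39)–(3.47) pp.397–398, Thm 3.13 p.426); CMP **96** (1984) 223–250
[Balaban1984PropagatorsII] ((2.51)–(2.52) p.232).
-/

set_option autoImplicit false

noncomputable section

namespace Summit.QuantumFields.YangMills.Theorems.Prop7SectET3KernelFamilyCanonical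

open Literature.MathematicalPhysics.QuantumFieldTheory.Balaban1983to89
open Literature.MathematicalPhysics.QuantumFieldTheory.Balaban1983to89.B9Thm34Ext (toB6)
open Literature.MathematicalPhysics.QuantumFieldTheory.Balaban1983to89.B11SectG (BlockNorm)
open Literature.MathematicalPhysics.QuantumFieldTheory.Balaban1983to89.B9SectDL2Decay (bl2)
open Literature.MathematicalPhysics.QuantumFieldTheory.Balaban1983to89.B9CoRealizesRel (CoRealizesRel)
open Literature.MathematicalPhysics.QuantumFieldTheory.Balaban1983to89.B9Ineq347CoReading (CoReadsGlob)
open Literature.MathematicalPhysics.QuantumFieldTheory.Balaban1983to89.B9RWSumsReadsNbr (nbr L2ReadsNbr H1ReadsNbr)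
open Literature.MathematicalPhysics.QuantumFieldTheory.Balaban1983to89.B9RWSums343Holder (HolderProbes)
open Literature.MathematicalPhysics.QuantumFieldTheory.Balaban1983to89.B9RWSums346SecondDiff (familyOp)
open Literature.MathematicalPhysics.QuantumFieldTheory.Balaban1983to89.B9RWSums344InputFam (sliceProbe InputReadsFam)
open Summit.QuantumFields.YangMills.Theorems.Prop7SectET3NormGCanonical (exists_glob_canonical)

/-! ## §1 Canonical entries: the infimum of the valid constants; the fibrewise sup relative to a site relation -/

section Entries

/-- ★ **THE INFIMUM OF THE VALID CONSTANTS** (print's (3.41) *«the smallest number C such, that …»*, for an arbitrary validity predicate `V a ·` on nonnegative constants):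
`f a := inf {t ≥ 0 : V a t}` is (i) nonnegative, (ii) below every valid nonnegative constant — the `obs` clause of each co-reading schema — and (iii) above every other lower reading
of the valid constants once one exists (canonicity). [folklore] -/
theorem exists_inf_canonical {α : Type} (V : α → ℝ → Prop) :
    ∃ f : α → ℝ, (∀ a, 0 ≤ f a) ∧ (∀ (a : α) (t : ℝ), 0 ≤ t → V a t → f a ≤ t) ∧
      (∀ (a : α) (e' : ℝ), (∀ t, 0 ≤ t → V a t → e' ≤ t) → (∃ t, 0 ≤ t ∧ V a t) → e' ≤ f a) := by
  refine ⟨fun a => sInf {t | 0 ≤ t ∧ V a t}, fun a => Real.sInf_nonneg fun t ht => ht.1, fun a t ht hV => csInf_le ⟨0, fun s hs => hs.1⟩ ⟨ht, hV⟩,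
    fun a e' h hne => ?_⟩
  obtain ⟨t, ht, hV⟩ := hne
  exact le_csInf ⟨t, ht, hV⟩ fun s hs => h s hs.1 hs.2

variable {g : B9.Geometry} {B : B9.Backgrounds} {u v : Type} [Fintype u]

/-- ★★ **THE CANONICAL (3.42)-TYPE ENTRY OF ONE BACKGROUND-INDEXED OPERATOR RELATIVE TO A SITE RELATION**: `e U λ y := sup ({0} ∪ {|(A U (ev λ))(x)| : Rel (bu x) y})` — a finite sup
over the output lattice — is (i) nonnegative, (ii) below every nonnegative common bound of `|(A U (ev λ))(x)|` over the outputs `x` with `Rel (bu x) y` (the `obs` clause of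
`CoRealizesRel` ∕ `InputReadsFam.obs4`), (iii) DOMINATING: `|(A U (ev λ))(x)| ≤ e U λ y` whenever `Rel (bu x) y`. [cite: Balaban1985BackgroundPropagators, (3.39) + (3.42) p.397, (3.44) p.398] -/
theorem exists_e_canonical (Rel : g.Site → g.Site → Prop) (bu : u → g.Site) (ev : g.Loc → v → ℝ) (A : B.Cfg → (v → ℝ) →ₗ[ℝ] (u → ℝ)) :
    ∃ e : B.Cfg → g.Loc → g.Site → ℝ,
      (∀ U lam y, 0 ≤ e U lam y) ∧
      (∀ (U : B.Cfg) (lam : g.Loc) (y : g.Site) (c : ℝ), 0 ≤ c → (∀ x : u, Rel (bu x) y → |A U (ev lam) x| ≤ c) → e U lam y ≤ c) ∧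
      (∀ (U : B.Cfg) (lam : g.Loc) (y : g.Site) (x : u), Rel (bu x) y → |A U (ev lam) x| ≤ e U lam y) := by
  classical
  let S : B.Cfg → g.Loc → g.Site → Set ℝ := fun U lam y => insert 0 {t | ∃ x : u, Rel (bu x) y ∧ t = |A U (ev lam) x|}
  have hsub : ∀ U lam y, {t | ∃ x : u, Rel (bu x) y ∧ t = |A U (ev lam) x|} ⊆ Set.range fun x : u => |A U (ev lam) x| := by
    rintro U lam y t ⟨x, -, rfl⟩
    exact ⟨x, rfl⟩
  have hfin : ∀ U lam y, (S U lam y).Finite := fun U lam y => ((Set.finite_range _).subset (hsub U lam y)).insert 0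
  have hbdd : ∀ U lam y, BddAbove (S U lam y) := fun U lam y => (hfin U lam y).bddAbove
  have hne : ∀ U lam y, (S U lam y).Nonempty := fun U lam y => ⟨0, Set.mem_insert 0 _⟩
  refine ⟨fun U lam y => sSup (S U lam y), fun U lam y => le_csSup (hbdd U lam y) (Set.mem_insert 0 _), fun U lam y c hc hobs => ?_,
    fun U lam y x hx => le_csSup (hbdd U lam y) (Set.mem_insert_of_mem 0 ⟨x, hx, rfl⟩)⟩
  refine csSup_le (hne U lam y) fun t ht => ?_
  rcases Set.mem_insert_iff.1 ht with h0 | ⟨x, hx, rfl⟩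
  · rw [h0]; exact hc
  · exact hobs x hx

end Entries

/-! ## §2 The canonical kernel family for the six structural rows of the 𝔊-side record leaf -/

section Structural

variable {g : B9.Geometry} [Fintype g.Site] {B : B9.Backgrounds} {R : ℝ} {H : Prop}
variable {X Y PX PY P : Type} [Fintype X] [Fintype Y] [Fintype P]

/-- ★★★ **THE CANONICAL KERNEL FAMILY FOR THE SIX STRUCTURAL ROWS.**  Data: model operators `G U` (𝔊(U)), `D U`∕`Dstar U` (∇_U∕∇*_U), direction letters `Dd U p`∕`Dds U p`, probes
`𝔭`, input block norms `bHX ε`, block maps `blk`∕`blkY`, evaluations `ev`∕`evY`, a site relation `Rel`, a radius `r`, an evaluation constant `Cev`, free members `e3`∕`g3`.  Hypotheses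
(ALL K-FREE): the evaluation rows `hoff hoffY hbd hbdY hwb hwbY hl2b hl2bY hloc hlocle` and the sign facts of the geometry.  Conclusion: ONE `K : B9.KernelFamily g B` with `K.e 3 = e3`,
`K.glob 3 = g3` satisfying, for EVERY `U`, verbatim the bodies of the rows `hcoR` (`CoRealizesRel` n = 0, 2), `hco1R` (n = 1), `hcoG` (`CoReadsGlob` n = 0, 1, 2), `hl2N` (`L2ReadsNbr`
n = 0,…,5), `hH1N` (`H1ReadsNbr`), `hIF` (`InputReadsFam`) of `normG_row_of_recordObligations` (there: `g := geo9K i`, `B := bgT3 i`, `Rel := RelB i`, `R := 1`, `H := H₀ i`, `G := (𝔬 i).GG`,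
`D := (𝔬 i).D`, `Dstar := (𝔬 i).Dstar`, `blk := (𝔬 i).blk`, `blkY := (𝔬 i).blkY`), together with the DOMINATIONS of the model by the entries `e 0, 1, 2`, `e4`, `glob 0, 1, 2` and their
nonnegativity.  Entries: (3.42)∕(3.44) fibrewise sups, (3.47) weighted sups (✓ `exists_glob_canonical`), (3.43)∕(3.45)∕(3.46) infima of the valid constants.
[cite: Balaban1985BackgroundPropagators, (3.39)–(3.47) pp.397–398, Thm 3.13 p.426; Balaban1984PropagatorsII, (2.51)–(2.52) p.232] -/
theorem exists_kernelFamily_structural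
    (G : B.Cfg → Module.End ℝ (X → ℝ)) (D : B.Cfg → (X → ℝ) →ₗ[ℝ] (Y → ℝ)) (Dstar : B.Cfg → (Y → ℝ) →ₗ[ℝ] (X → ℝ))
    (Dd Dds : B.Cfg → P → Module.End ℝ (X → ℝ)) (𝔭 : HolderProbes g B X Y PX PY) (bHX : ℝ → BlockNorm (toB6 g R H) (X → ℝ))
    (blk : X → g.Site) (blkY : Y → g.Site) (ev : g.Loc → X → ℝ) (evY : g.Loc → Y → ℝ)
    (Rel : g.Site → g.Site → Prop) (r Cev : ℝ) (e3 : B.Cfg → g.Loc → g.Site → ℝ) (g3 : B.Cfg → g.Loc → ℝ → ℝ)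
    -- ======== the K-free evaluation rows ========
    (hoff : ∀ (lam : g.Loc) (y' : g.Site), g.suppIn lam y' → ∀ x : X, ¬ Rel (blk x) y' → ev lam x = 0)
    (hoffY : ∀ (lam : g.Loc) (y' : g.Site), g.suppIn lam y' → ∀ w : Y, ¬ Rel (blkY w) y' → evY lam w = 0)
    (hbd : ∀ (lam : g.Loc) (x : X), |ev lam x| ≤ g.supNorm lam) (hbdY : ∀ (lam : g.Loc) (w : Y), |evY lam w| ≤ g.supNorm lam)
    (hwb : ∀ (lam : g.Loc) (γ : ℝ) (x : X), |ev lam x| ≤ g.len (blk x) ^ γ * g.wNorm γ lam)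
    (hwbY : ∀ (lam : g.Loc) (γ : ℝ) (w : Y), |evY lam w| ≤ g.len (blkY w) ^ γ * g.wNorm γ lam)
    (hl2b : ∀ (lam : g.Loc) (y' y'' : g.Site), g.suppIn lam y' → Rel y'' y' → bl2 (g := toB6 g R H) blk y'' (ev lam) ≤ Cev * g.l2Norm lam)
    (hl2bY : ∀ (lam : g.Loc) (y' y'' : g.Site), g.suppIn lam y' → Rel y'' y' → bl2 (g := toB6 g R H) blkY y'' (evY lam) ≤ Cev * g.l2Norm lam)
    (hloc : ∀ (ε : ℝ) (lam : g.Loc) (y' : g.Site), g.suppInT lam y' → (bHX ε).IsLoc y' (ev lam))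
    (hlocle : ∀ (ε : ℝ) (lam : g.Loc) (y' : g.Site), g.suppInT lam y' → (bHX ε).loc y' (ev lam) ≤ g.holder ε lam + g.supNorm lam)
    -- ======== the sign facts of the geometry ========
    (hsup : ∀ lam : g.Loc, 0 ≤ g.supNorm lam) (hl2n : ∀ lam : g.Loc, 0 ≤ g.l2Norm lam) (hcS : ∀ h : g.Cut, 0 ≤ g.cutSup h)
    (hcH : ∀ (β : ℝ) (ζ : g.Cut), 0 ≤ g.cutH β ζ) (hho : ∀ (ε : ℝ) (lam : g.Loc), 0 ≤ g.holder ε lam) (hlen : ∀ y : g.Site, 0 < g.len y) :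
    ∃ K : B9.KernelFamily g B, K.e 3 = e3 ∧ K.glob 3 = g3 ∧
      -- `hcoR`
      (∀ U : B.Cfg, CoRealizesRel K 0 U Rel blk blk ev (G U) ∧ CoRealizesRel K 2 U Rel blk blkY evY (G U ∘ₗ Dstar U)) ∧
      -- `hco1R`
      (∀ U : B.Cfg, CoRealizesRel K 1 U Rel blkY blk ev (D U ∘ₗ G U)) ∧
      -- `hcoG`
      (∀ U : B.Cfg, CoReadsGlob K 0 U blk blk ev (G U) ∧ CoReadsGlob K 1 U blkY blk ev (D U ∘ₗ G U) ∧ CoReadsGlob K 2 U blk blkY evY (G U ∘ₗ Dstar U)) ∧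
      -- `hl2N`
      (∀ U : B.Cfg,
        L2ReadsNbr (R := R) (H := H) K 0 U Rel r Cev blk blk ev (G U) ∧
        L2ReadsNbr (R := R) (H := H) K 1 U Rel r Cev blkY blk ev (D U ∘ₗ G U) ∧
        L2ReadsNbr (R := R) (H := H) K 2 U Rel r Cev blk blkY evY (G U ∘ₗ Dstar U) ∧
        L2ReadsNbr (R := R) (H := H) K 3 U Rel r Cev (blk ∘ Prod.fst) blk ev (familyOp (fun q : P × P => Dd U q.1 ∘ₗ (G U ∘ₗ Dds U q.2))) ∧
        L2ReadsNbr (R := R) (H := H) K 4 U Rel r Cev (blk ∘ Prod.fst) blk ev (familyOp (fun q : P × P => (Dd U q.1 ∘ₗ Dd U q.2) ∘ₗ G U)) ∧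
        L2ReadsNbr (R := R) (H := H) K 5 U Rel r Cev (blk ∘ Prod.fst) blk ev (familyOp (fun q : P × P => G U ∘ₗ (Dds U q.1 ∘ₗ Dds U q.2)))) ∧
      -- `hH1N`
      (∀ U : B.Cfg, H1ReadsNbr K U 𝔭 Rel r blk blkY ev evY (D U ∘ₗ G U) (G U ∘ₗ Dstar U)) ∧
      -- `hIF`
      (∀ U : B.Cfg, InputReadsFam K U bHX r (blk ∘ Prod.fst) (𝔭.blkPX ∘ Prod.fst) (fun β => sliceProbe (𝔭.ΦX U β)) ev
        (familyOp (fun q : P × P => Dd U q.1 ∘ₗ (G U ∘ₗ Dds U q.2)))) ∧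
      -- dominations and signs of the canonical entries
      (∀ (U : B.Cfg) (lam : g.Loc) (y : g.Site) (x : X), Rel (blk x) y → |G U (ev lam) x| ≤ K.e 0 U lam y) ∧
      (∀ (U : B.Cfg) (lam : g.Loc) (y : g.Site) (w : Y), Rel (blkY w) y → |(D U ∘ₗ G U) (ev lam) w| ≤ K.e 1 U lam y) ∧
      (∀ (U : B.Cfg) (lam : g.Loc) (y : g.Site) (x : X), Rel (blk x) y → |(G U ∘ₗ Dstar U) (evY lam) x| ≤ K.e 2 U lam y) ∧
      (∀ (U : B.Cfg) (lam : g.Loc) (y : g.Site) (xq : X × (P × P)), g.dist (blk xq.1) y ≤ r →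
        |(familyOp (fun q : P × P => Dd U q.1 ∘ₗ (G U ∘ₗ Dds U q.2))) (ev lam) xq| ≤ K.e4 U lam y) ∧
      (∀ (U : B.Cfg) (lam : g.Loc) (γ : ℝ) (x : X), |G U (ev lam) x| ≤ K.glob 0 U lam γ * B9.pref4 (g.len (blk x)) 0 * g.len (blk x) ^ γ) ∧
      (∀ (U : B.Cfg) (lam : g.Loc) (γ : ℝ) (w : Y), |(D U ∘ₗ G U) (ev lam) w| ≤ K.glob 1 U lam γ * B9.pref4 (g.len (blkY w)) 1 * g.len (blkY w) ^ γ) ∧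
      (∀ (U : B.Cfg) (lam : g.Loc) (γ : ℝ) (x : X), |(G U ∘ₗ Dstar U) (evY lam) x| ≤ K.glob 2 U lam γ * B9.pref4 (g.len (blk x)) 2 * g.len (blk x) ^ γ) ∧
      (∀ U lam, (∀ y, 0 ≤ K.e 0 U lam y ∧ 0 ≤ K.e 1 U lam y ∧ 0 ≤ K.e 2 U lam y ∧ 0 ≤ K.e4 U lam y) ∧
        (∀ γ, 0 ≤ K.glob 0 U lam γ ∧ 0 ≤ K.glob 1 U lam γ ∧ 0 ≤ K.glob 2 U lam γ) ∧
        (∀ β ζ, 0 ≤ K.h1 U lam β ζ ∧ 0 ≤ K.h2 U lam β ζ) ∧ (∀ (n : Fin 6) (h : g.Cut), 0 ≤ K.l2 n U lam h)) := by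
  classical
  -- the (3.42) entries and the (3.44) entry: fibrewise sups with domination
  obtain ⟨e₀, he₀0, he₀obs, he₀dom⟩ := exists_e_canonical (B := B) Rel blk ev G
  obtain ⟨e₁, he₁0, he₁obs, he₁dom⟩ := exists_e_canonical (B := B) Rel blkY ev (fun U => D U ∘ₗ G U)
  obtain ⟨e₂, he₂0, he₂obs, he₂dom⟩ := exists_e_canonical (B := B) Rel blk evY (fun U => G U ∘ₗ Dstar U)
  obtain ⟨e₄, he₄0, he₄obs, he₄dom⟩ := exists_e_canonical (B := B) (fun a b => g.dist a b ≤ r) (blk ∘ Prod.fst) ev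
    (fun U => familyOp (fun q : P × P => Dd U q.1 ∘ₗ (G U ∘ₗ Dds U q.2)))
  -- the (3.47) entries: weighted sups with domination
  obtain ⟨gl₀, hg₀0, hg₀obs, hg₀dom⟩ := exists_glob_canonical (B := B) 0 blk ev G hlen
  obtain ⟨gl₁, hg₁0, hg₁obs, hg₁dom⟩ := exists_glob_canonical (B := B) 1 blkY ev (fun U => D U ∘ₗ G U) hlen
  obtain ⟨gl₂, hg₂0, hg₂obs, hg₂dom⟩ := exists_glob_canonical (B := B) 2 blk evY (fun U => G U ∘ₗ Dstar U) hlen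
  -- the (3.43) and (3.45) Hölder quantities: infima of the valid constants
  obtain ⟨f₁, hf₁0, hf₁obs, -⟩ := exists_inf_canonical (α := B.Cfg × g.Loc × ℝ × g.Cut) fun a t =>
    ∃ (y : g.Site) (c : ℝ), 0 ≤ c ∧ g.cutInT a.2.2.2 y ∧
      (∀ p : PY, g.dist (𝔭.blkPY p) y ≤ r → |𝔭.ΦY a.1 a.2.2.1 ((D a.1 ∘ₗ G a.1) (ev a.2.1)) p| ≤ c) ∧
      (∀ p : PX, g.dist (𝔭.blkPX p) y ≤ r → |𝔭.ΦX a.1 a.2.2.1 ((G a.1 ∘ₗ Dstar a.1) (evY a.2.1)) p| ≤ c) ∧ t = c * g.cutH a.2.2.1 a.2.2.2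
  obtain ⟨f₂, hf₂0, hf₂obs, -⟩ := exists_inf_canonical (α := B.Cfg × g.Loc × ℝ × g.Cut) fun a t =>
    ∃ (y : g.Site) (c : ℝ), 0 ≤ c ∧ g.cutInT a.2.2.2 y ∧
      (∀ p : PX × (P × P), g.dist ((𝔭.blkPX ∘ Prod.fst) p) y ≤ r →
        |(sliceProbe (𝔭.ΦX a.1 a.2.2.1)) ((familyOp (fun q : P × P => Dd a.1 q.1 ∘ₗ (G a.1 ∘ₗ Dds a.1 q.2))) (ev a.2.1)) p| ≤ c) ∧
      t = c * g.cutH a.2.2.1 a.2.2.2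
  -- the six (3.46) entries: infima of the valid constants
  have hL2 : ∀ {u w : Type} [Fintype u] (bu : u → g.Site) (ew : g.Loc → w → ℝ) (T : B.Cfg → (w → ℝ) →ₗ[ℝ] (u → ℝ)),
      ∃ f : B.Cfg → g.Loc → g.Cut → ℝ, (∀ U lam h, 0 ≤ f U lam h) ∧
        ∀ (U : B.Cfg) (lam : g.Loc) (h : g.Cut) (y : g.Site) (c : ℝ), 0 ≤ c → g.cutIn h y →
          (∑ y'' ∈ nbr g r y, bl2 (g := toB6 g R H) bu y'' (T U (ew lam))) * g.cutSup h ≤ c → f U lam h ≤ c := by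
    intro u w _ bu ew T
    obtain ⟨f, hf0, hfobs, -⟩ := exists_inf_canonical (α := B.Cfg × g.Loc × g.Cut) fun a t =>
      ∃ y : g.Site, g.cutIn a.2.2 y ∧ (∑ y'' ∈ nbr g r y, bl2 (g := toB6 g R H) bu y'' (T a.1 (ew a.2.1))) * g.cutSup a.2.2 ≤ t
    exact ⟨fun U lam h => f (U, lam, h), fun U lam h => hf0 _, fun U lam h y c hc hy hs => hfobs (U, lam, h) c hc ⟨y, hy, hs⟩⟩
  obtain ⟨l₀, hl₀0, hl₀obs⟩ := hL2 blk ev G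
  obtain ⟨l₁, hl₁0, hl₁obs⟩ := hL2 blkY ev (fun U => D U ∘ₗ G U)
  obtain ⟨l₂, hl₂0, hl₂obs⟩ := hL2 blk evY (fun U => G U ∘ₗ Dstar U)
  obtain ⟨l₃, hl₃0, hl₃obs⟩ := hL2 (blk ∘ Prod.fst) ev (fun U => familyOp (fun q : P × P => Dd U q.1 ∘ₗ (G U ∘ₗ Dds U q.2)))
  obtain ⟨l₄, hl₄0, hl₄obs⟩ := hL2 (blk ∘ Prod.fst) ev (fun U => familyOp (fun q : P × P => (Dd U q.1 ∘ₗ Dd U q.2) ∘ₗ G U))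
  obtain ⟨l₅, hl₅0, hl₅obs⟩ := hL2 (blk ∘ Prod.fst) ev (fun U => familyOp (fun q : P × P => G U ∘ₗ (Dds U q.1 ∘ₗ Dds U q.2)))
  -- the family
  refine ⟨⟨![e₀, e₁, e₂, e3], fun U lam β ζ => f₁ (U, lam, β, ζ), e₄, fun U lam β ζ => f₂ (U, lam, β, ζ), ![l₀, l₁, l₂, l₃, l₄, l₅], ![gl₀, gl₁, gl₂, g3]⟩,
    rfl, rfl, fun U => ⟨?_, ?_⟩, fun U => ?_, fun U => ⟨?_, ?_, ?_⟩, fun U => ⟨?_, ?_, ?_, ?_, ?_, ?_⟩, fun U => ?_, fun U => ?_,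
    fun U lam y x hx => ?_, fun U lam y w hw => ?_, fun U lam y x hx => ?_, fun U lam y xq hxq => ?_,
    fun U lam γ x => ?_, fun U lam γ w => ?_, fun U lam γ x => ?_, fun U lam => ⟨fun y => ⟨?_, ?_, ?_, ?_⟩, fun γ => ⟨?_, ?_, ?_⟩, fun β ζ => ⟨?_, ?_⟩, fun n h => ?_⟩⟩
  -- `hcoR`
  · exact { off := hoff, bound := hbd, norm_nonneg := hsup, obs := fun lam y c hc h => by simpa using he₀obs U lam y c hc h }
  · exact { off := hoffY, bound := hbdY, norm_nonneg := hsup, obs := fun lam y c hc h => by simpa using he₂obs U lam y c hc h }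
  -- `hco1R`
  · exact { off := hoff, bound := hbd, norm_nonneg := hsup, obs := fun lam y c hc h => by simpa using he₁obs U lam y c hc h }
  -- `hcoG`
  · exact ⟨hwb, fun lam γ C hC h => by simpa using hg₀obs U lam γ C hC h⟩
  · exact ⟨hwb, fun lam γ C hC h => by simpa using hg₁obs U lam γ C hC h⟩
  · exact ⟨hwbY, fun lam γ C hC h => by simpa using hg₂obs U lam γ C hC h⟩
  -- `hl2N`
  · exact { off := hoff, l2bound := hl2b, l2norm_nonneg := hl2n, cutSup_nonneg := hcS,
            obs := fun lam h y c hc hy hs => by simpa using hl₀obs U lam h y c hc hy hs }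
  · exact { off := hoff, l2bound := hl2b, l2norm_nonneg := hl2n, cutSup_nonneg := hcS,
            obs := fun lam h y c hc hy hs => by simpa using hl₁obs U lam h y c hc hy hs }
  · exact { off := hoffY, l2bound := hl2bY, l2norm_nonneg := hl2n, cutSup_nonneg := hcS,
            obs := fun lam h y c hc hy hs => by simpa using hl₂obs U lam h y c hc hy hs }
  · exact { off := hoff, l2bound := hl2b, l2norm_nonneg := hl2n, cutSup_nonneg := hcS,
            obs := fun lam h y c hc hy hs => by simpa using hl₃obs U lam h y c hc hy hs }
  · exact { off := hoff, l2bound := hl2b, l2norm_nonneg := hl2n, cutSup_nonneg := hcS,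
            obs := fun lam h y c hc hy hs => by simpa using hl₄obs U lam h y c hc hy hs }
  · exact { off := hoff, l2bound := hl2b, l2norm_nonneg := hl2n, cutSup_nonneg := hcS,
            obs := fun lam h y c hc hy hs => by simpa using hl₅obs U lam h y c hc hy hs }
  -- `hH1N`
  · exact { off := hoff, bound := hbd, offY := hoffY, boundY := hbdY, norm_nonneg := hsup, cutH_nonneg := hcH,
            obs := fun lam β ζ y c hc hy hL hR =>
              hf₁obs (U, lam, β, ζ) (c * g.cutH β ζ) (mul_nonneg hc (hcH β ζ)) ⟨y, c, hc, hy, hL, hR, rfl⟩ }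
  -- `hIF`
  · exact { isLoc := hloc, loc_le := hlocle, hs_nonneg := fun ε lam => add_nonneg (hho ε lam) (hsup lam), cutH_nonneg := hcH,
            obs4 := fun lam y c hc h => he₄obs U lam y c hc fun xq hxq => h xq hxq,
            obs5 := fun lam β ζ y c hc hy h =>
              hf₂obs (U, lam, β, ζ) (c * g.cutH β ζ) (mul_nonneg hc (hcH β ζ)) ⟨y, c, hc, hy, h, rfl⟩ }
  -- dominations
  · simpa using he₀dom U lam y x hx
  · simpa using he₁dom U lam y w hw
  · simpa using he₂dom U lam y x hx
  · exact he₄dom U lam y xq hxq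
  · simpa using hg₀dom U lam γ x
  · simpa using hg₁dom U lam γ w
  · simpa using hg₂dom U lam γ x
  -- signs
  · simpa using he₀0 U lam y
  · simpa using he₁0 U lam y
  · simpa using he₂0 U lam y
  · exact he₄0 U lam y
  · simpa using hg₀0 U lam γ
  · simpa using hg₁0 U lam γ
  · simpa using hg₂0 U lam γ
  · exact hf₁0 _
  · exact hf₂0 _
  · fin_cases n
    · simpa using hl₀0 U lam h
    · simpa using hl₁0 U lam h
    · simpa using hl₂0 U lam h
    · simpa using hl₃0 U lam h
    · simpa using hl₄0 U lam h
    · simpa using hl₅0 U lam h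

end Structural

end Summit.QuantumFields.YangMills.Theorems.Prop7SectET3KernelFamilyCanonical

end
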